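import Literature.AlgebraicGeometry.Motives.ZariskiChowCover
import Literature.AlgebraicGeometry.Motives.GoodReductionFormalFunctionsProofs
import Literature.AlgebraicGeometry.Motives.AbelianVarietyProofs
import Literature.AlgebraicGeometry.Morphisms.FormalFunctionsCechProofs
import Literature.AlgebraicGeometry.Morphisms.CechH1ProjectiveFinite
import Literature.AlgebraicGeometry.Resolution.ChowLemmaRing
import Literature.AlgebraicGeometry.Resolution.ReducedOfSmoothOverReduced
import Mathlib.RingTheory.DiscreteValuationRing.Basic
import Mathlib.RingTheory.DedekindDomain.Dvr
import Mathlib.RingTheory.Localization.LocalizationLocalization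
import Mathlib.CategoryTheory.Limits.Shapes.Pullback.Pasting
import HarnessLib

/-!
# Zariski's connectedness theorem for smooth proper schemes over a discrete valuation ring

Let `R` be a discrete valuation ring with fraction field `K` and let `q : R ↠ k₀` be a surjection
onto a field (necessarily the residue field). Let `f : X → Spec R` be proper and smooth of relative
dimension `n`, with geometrically irreducible generic fibre `X_K = X ×_R K`. Then the special fibre
`X₀ = X ×_R k₀` satisfies `H⁰(X₀, 𝒪) = k₀`, is geometrically connected, geometrically irreducible and
geometrically integral over `k₀` (Stacks Project, Tag 0E0N / 03H0 with 056T; SGA 1 X 1.2; EGA IV₃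
15.5.4), provided `K` and `k₀` are perfect (automatic in characteristic `0`; `k₀` finite also works).

This is the BASE-GENERIC form of `IntegralModel.geometricallyIrreducible_reductionAt_holds`
(`Literature/AlgebraicGeometry/Motives/GoodReductionZariskiProofs.lean`), which is the same theorem
for the local rings `𝓞_{K,v}` of number fields only. The proof is that file's proof, verbatim up to
the base: every heavy input there is already stated over a general base in the tree —

1. `X` is integral (`Resolution.isReduced_of_smooth_of_isReduced_base`, Stacks 034E;
   `ZariskiChow.irreducibleSpace_of_genericFibre`);
2. Chow's lemma over `R` (`Resolution.ChowLemmaRing.chow_proper`, Görtz–Wedhorn Thm. 13.100 /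
   Stacks 02O2): `π : Z → X` proper surjective, `Z` integral, `Z ↪ ℙᴺ_R` closed, `π` an iso over a
   dense open `U`;
3. `Z → Spec R` is flat (`ZariskiChow.flat_of_isIntegral_of_surjective`, Hartshorne III 9.7),
   `Γ(Z, 𝒪_Z) = R` (`bijective_appTop_of_genericFibre`, Stacks 0AY8, with
   `ZariskiChow.mem_range_of_isIntegralElem_chowCover`), `Ȟ¹(Z, 𝒪_Z)` finitely generated (Serre,
   `Morphisms.ProjCech.moduleFinite_cechH1`), hence the theorem on formal functions for `H⁰` on `Z`
   (`Morphisms.hasSurjectiveFormalFunctions_of_finite_cechH1`, Stacks 02OC) for the ideal `(ϖ) = ker q`;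
4. a function on the reduced fibre `X₀` is a simple root of its minimal polynomial over the perfect
   `k₀` (`isUnit_aeval_derivative_minpoly`), its pull-back to `Z₀` is constant by Hensel lifting +
   formal functions (`mem_range_algebraMapΓ_of_isRoot`, proof of Stacks 03H0), and `Z₀ → X₀` is
   surjective (`isNilpotent_of_app_eq_zero`), so `H⁰(X₀, 𝒪) = k₀`;
5. flat base change of `H⁰` (`geometricallyConnected_of_isIso_appTop`, Stacks 02KH) and smoothness
   (`geometricallyIrreducible_of_geometricallyConnected_of_smoothOfRelativeDimension`, Stacks 056T).

Over a DEDEKIND domain `R` (`geometricallyIntegral_fibre_of_isDedekindDomain`): the fibre of such an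
`f : X → Spec R` over a closed point `𝔪 ≠ 0`, presented by any surjection `q : R ↠ k₀` onto a perfect
field with `ker q ≠ ⊥` (e.g. `Ideal.Quotient.mk 𝔪` under `letI := Ideal.Quotient.field 𝔪`, with
`Ideal.Quotient.mk_surjective` and `Ideal.mk_ker`), is geometrically integral — base change to the
discrete valuation ring `R_𝔪` and pullback pasting (`pullbackLeftPullbackSndIso`).

Plain `Smooth f` (no fixed relative dimension) suffices: `exists_smoothOfRelativeDimension`
(irreducible source ⇒ constant relative dimension, the tree's `exists_smoothOfRelativeDimension_of_smooth`),
`geometricallyIntegral_specialFibre_of_smooth`, `geometricallyIntegral_fibre_of_isDedekindDomain_of_smooth`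
— the hypotheses `IsProper ∧ Smooth` being exactly what the spreading-out theorem
`Literature.NumberTheory.EllipticCurves.exists_abelianScheme_away_holds` delivers.

The only number-field-specific glue of the original (`𝓞_{K,v}` is a DVR; `ker (residueAt v) = (ϖ)`;
`residueAt v` surjective) is replaced by `IsDiscreteValuationRing.exists_irreducible`,
`Irreducible.maximalIdeal_eq` and the hypothesis `Function.Surjective q`.

Motivation (cell abc-iut, FACT-LIST row F-0369 `Rmk_1_5_4_i`, route memo F0369-FG-ROUTE junction J-b):
the special fibre of the spread-out abelian scheme of an abelian variety over a finitely generated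
extension of `ℚ_p`, at a closed point of a Dedekind curve model, must again be an abelian variety —
i.e. GEOMETRICALLY INTEGRAL — for the induction on transcendence degree; over `ℚ_p` all residue
fields have characteristic `0`, so the perfectness hypotheses are free. PROOF-ONLY file (no
definitions); Mathlib + tree only; nothing here bears on [IUTchIII] Cor. 3.12.

## References

* The Stacks Project, Tags 03H0, 0E0N (Zariski's connectedness theorem), 0AY8, 02OC (theorem on
  formal functions), 02O2 (Chow's lemma), 056T, 02KH. [StacksProject]
* A. Grothendieck, EGA IV₃ (Publ. Math. IHÉS 28, 1966), Théorème 15.5.4; SGA 1, Exposé X, 1.2.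
* R. Hartshorne, *Algebraic Geometry*, GTM 52 (1977): III Thm. 5.2 (a), III Cor. 11.3, III Prop. 9.7.
  [Hartshorne1977]
-/

noncomputable section

universe u

open CategoryTheory CategoryTheory.Limits AlgebraicGeometry TopologicalSpace Opposite Polynomial

namespace Literature.AlgebraicGeometry.Motives.ZariskiDVR

open Morphisms

variable {R K : Type u} [CommRing R] [IsDomain R] [IsDiscreteValuationRing R] [Field K] [Algebra R K]
  [IsFractionRing R K] {X : Scheme.{u}} (f : X ⟶ Spec (.of R))

omit [IsDomain R] [IsDiscreteValuationRing R] [IsFractionRing R K] in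
/-- **The generic fibre of a smooth `f : X → Spec R` with geometrically irreducible generic fibre
is an integral scheme** (irreducible by hypothesis, reduced because smooth over the field `K`,
Stacks 056T). [cite: StacksProject, Tag 056T (Varieties, Lemma 33.25.4)] -/
theorem isIntegral_genericFibre (n : ℕ) [SmoothOfRelativeDimension n f]
    [GeometricallyIrreducible (pullback.snd f (Spec.map (CommRingCat.ofHom (algebraMap R K))))] :
    IsIntegral (pullback f (Spec.map (CommRingCat.ofHom (algebraMap R K)))) := by
  haveI := smoothOfRelativeDimension_isStableUnderBaseChange (n := n)
  set i : Spec (.of K) ⟶ Spec (.of R) := Spec.map (CommRingCat.ofHom (algebraMap R K)) with hi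
  haveI : IrreducibleSpace ↥(pullback f i) :=
    GeometricallyIrreducible.irreducibleSpace_of_subsingleton (f := pullback.snd f i)
  haveI : SmoothOfRelativeDimension n (pullback.snd f i) := MorphismProperty.pullback_snd _ _ ‹_›
  haveI : IsReduced (pullback f i) := isReduced_of_smoothOfRelativeDimension (pullback.snd f i) n
  exact isIntegral_of_irreducibleSpace_of_isReduced _

/-- **The total space of a smooth `X → Spec R` (`R` a discrete valuation ring) with geometrically
irreducible generic fibre is an integral scheme**: reduced (smooth over the reduced Noetherian
`Spec R`, Stacks 034E) and irreducible (its generic fibre is irreducible and dense, `f` being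
universally open). [cite: StacksProject, Tag 034E (Descent, Lemma 35.18.1-type statement: smooth over reduced is reduced)] -/
theorem isIntegral_total (n : ℕ) [SmoothOfRelativeDimension n f]
    [GeometricallyIrreducible (pullback.snd f (Spec.map (CommRingCat.ofHom (algebraMap R K))))] :
    IsIntegral X := by
  haveI : Smooth f := SmoothOfRelativeDimension.smooth n _
  haveI := isIntegral_genericFibre (K := K) f n
  haveI : IrreducibleSpace ↥X := ZariskiChow.irreducibleSpace_of_genericFibre (K := K) f
  haveI : IsReduced X := Resolution.isReduced_of_smooth_of_isReduced_base f
  exact isIntegral_of_irreducibleSpace_of_isReduced _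

omit [IsDiscreteValuationRing R] [IsFractionRing R K] in
/-- A proper smooth `X → Spec R` (`R` a domain) with geometrically irreducible (hence non-empty)
generic fibre is surjective: its image is open (flat and of finite type ⇒ open, Hartshorne III
Ex. 9.1), closed (proper, Hartshorne II §4) and non-empty in the connected `Spec R`.
[cite: Hartshorne1977, III Ex. 9.1 (p. 266) with II Cor. 4.8] -/
theorem surjective_of_isProper (n : ℕ) [SmoothOfRelativeDimension n f] [IsProper f]
    [GeometricallyIrreducible (pullback.snd f (Spec.map (CommRingCat.ofHom (algebraMap R K))))] :
    Surjective f := by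
  haveI : Smooth f := SmoothOfRelativeDimension.smooth n _
  set i : Spec (.of K) ⟶ Spec (.of R) := Spec.map (CommRingCat.ofHom (algebraMap R K)) with hi
  haveI : IrreducibleSpace ↥(pullback f i) :=
    GeometricallyIrreducible.irreducibleSpace_of_subsingleton (f := pullback.snd f i)
  haveI : Nonempty ↥X := ⟨(pullback.fst f i).base (Classical.arbitrary _)⟩
  have hopen : IsOpen (Set.range f.base) := f.isOpenMap.isOpen_range
  have hclosed : IsClosed (Set.range f.base) := f.isClosedMap.isClosed_range
  exact ⟨Set.range_eq_univ.mp (IsClopen.eq_univ ⟨hclosed, hopen⟩ (Set.range_nonempty _))⟩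

omit [IsFractionRing R K] [Algebra R K] [Field K] in
/-- For a discrete valuation ring `R`, the kernel of a surjection `q : R ↠ k₀` onto a field is the
maximal ideal, generated by a uniformiser `ϖ`, a non-zero-divisor (Mathlib
`IsDiscreteValuationRing.exists_irreducible`, `Irreducible.maximalIdeal_eq`). [folklore] -/
private theorem exists_ker_eq_span {k₀ : Type*} [Field k₀] (q : R →+* k₀) (hq : Function.Surjective q) :
    ∃ ϖ : R, ϖ ∈ nonZeroDivisors R ∧ RingHom.ker q = Ideal.span {ϖ} := by
  obtain ⟨ϖ, hϖ⟩ := IsDiscreteValuationRing.exists_irreducible R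
  have hmax : (RingHom.ker q).IsMaximal := RingHom.ker_isMaximal_of_surjective q hq
  have hker : RingHom.ker q = IsLocalRing.maximalIdeal R := IsLocalRing.eq_maximalIdeal hmax
  exact ⟨ϖ, mem_nonZeroDivisors_of_ne_zero hϖ.ne_zero, hker.trans hϖ.maximalIdeal_eq⟩

variable {k₀ : Type u} [Field k₀] (q : R →+* k₀)

/-- **`H⁰(X₀, 𝒪) = k₀` for the special fibre of a smooth proper scheme over a discrete valuation
ring** with geometrically irreducible generic fibre (Zariski's connectedness theorem via a projective
cover, the printed proof of Stacks Project, Tag 03H0 with Tag 02OC run on a Chow cover): see the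
module docstring, steps 1–4. Hypotheses: `R` a DVR with perfect fraction field `K`, `q : R ↠ k₀` a
surjection onto a perfect field, `f` proper and smooth of relative dimension `n`.
[cite: StacksProject, Tags 02O2, 02OC and 03H0 (Chow's lemma; theorem on formal functions; Zariski's connectedness theorem, proof)] -/
theorem isIso_appTop_specialFibre [PerfectField K] [PerfectField k₀] (hq : Function.Surjective q)
    (n : ℕ) [SmoothOfRelativeDimension n f] [IsProper f]
    [GeometricallyIrreducible (pullback.snd f (Spec.map (CommRingCat.ofHom (algebraMap R K))))] :
    IsIso (pullback.snd f (Spec.map (CommRingCat.ofHom q))).appTop := by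
  classical
  haveI : Smooth f := SmoothOfRelativeDimension.smooth n _
  haveI := smoothOfRelativeDimension_isStableUnderBaseChange (n := n)
  haveI : IsOpenImmersion (Spec.map (CommRingCat.ofHom (algebraMap R K))) :=
    ZariskiChow.isOpenImmersion_specMap_algebraMap R K
  haveI := isIntegral_genericFibre (K := K) f n
  haveI : IsIntegral X := isIntegral_total (K := K) f n
  haveI : Surjective f := surjective_of_isProper (K := K) f n
  /- Chow's lemma over `R` -/
  obtain ⟨N, Z, π, ι, hZint, hιci, hπproper, hπsurj, hιf, U, hUdense, -, hUiso⟩ :=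
    Resolution.ChowLemmaRing.chow_proper X f
  haveI := hZint; haveI := hπproper; haveI := hπsurj; haveI := hUiso
  -- the closed immersion `ι : Z ↪ ℙᴺ`, at the type used by `ProjCech`
  haveI hιci' : IsClosedImmersion (Y := Morphisms.ProjCech.PP R N) ι := hιci
  have hUne : (U : Set X).Nonempty := hUdense.nonempty
  set g : Z ⟶ Spec (.of R) := π ≫ f with hg
  haveI : Surjective g := inferInstance
  haveI : IsProper g := inferInstance
  haveI : Flat g := ZariskiChow.flat_of_isIntegral_of_surjective g
  /- `Γ(Z, 𝒪_Z) = R` -/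
  haveI : Nonempty ↥(pullback g (Spec.map (CommRingCat.ofHom (algebraMap R K)))) := by
    obtain ⟨w⟩ := ZariskiChow.nonempty_preimage_preimage (K := K) f π U hUne
    exact ⟨w.1⟩
  have hΓ : Function.Bijective g.appTop :=
    bijective_appTop_of_genericFibre (K := K) g fun b hb =>
      ZariskiChow.mem_range_of_isIntegralElem_chowCover (K := K) f π U hUne b hb
  have hΓ' : Function.Bijective (algebraMapΓ g) :=
    hΓ.comp (Scheme.ΓSpecIso (.of R)).symm.commRingCatIsoToRingEquiv.bijective
  /- the theorem on formal functions for `Z` (Serre finiteness for the projective `Z`) -/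
  have hstr : Morphisms.ProjCech.strZ ι = g := hιf
  haveI : Flat (Morphisms.ProjCech.strZ ι) := by rw [hstr]; infer_instance
  have hfin := Morphisms.ProjCech.moduleFinite_cechH1 ι
  obtain ⟨ϖ, hϖ, hker⟩ := exists_ker_eq_span q hq
  have hFF0 := Morphisms.hasSurjectiveFormalFunctions_of_finite_cechH1 (f := Morphisms.ProjCech.strZ ι) hϖ
    (Morphisms.ProjCech.cover ι) (Morphisms.ProjCech.isAffineOpen_cover ι) (Morphisms.ProjCech.iSup_cover_eq_top ι) hfin
  have hFF : HasSurjectiveFormalFunctions (RingHom.ker q) g := by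
    rw [hker, ← hstr]; exact hFF0
  /- the fibres over the closed point -/
  set j := Spec.map (CommRingCat.ofHom q) with hj
  set gk := pullback.snd f j with hgk
  set Λ := Γ(pullback f j, ⊤) with hΛ
  haveI : SmoothOfRelativeDimension n gk := MorphismProperty.pullback_snd _ _ ‹_›
  haveI : IsReduced (pullback f j) := isReduced_of_smoothOfRelativeDimension gk n
  haveI : Nonempty ↥(pullback f j) := by
    obtain ⟨y, -⟩ := gk.surjective (Classical.arbitrary _)
    exact ⟨y⟩
  -- the comparison `Z₀ → X₀`, a base change of `π`, hence surjective
  have e₂ : j = 𝟙 _ ≫ j := (Category.id_comp _).symm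
  set mk := pullback.map g j f j π (𝟙 _) (𝟙 _) ((Category.comp_id _).trans hg) ((Category.comp_id _).trans e₂)
    with hmk
  haveI : Surjective mk := MorphismProperty.pullbackMap (P := @Surjective) inferInstance inferInstance hg e₂
  have hmk₂ : mk ≫ gk = pullback.snd g j := by
    rw [hmk, hgk, pullback.lift_snd, Category.comp_id]
  have hcomp : algebraMapΓ (pullback.snd g j) = mk.appTop.hom.comp (algebraMapΓ gk) := by
    rw [algebraMapΓ, algebraMapΓ, ← hmk₂, Scheme.Hom.comp_appTop]
    rfl
  /- every function on `X₀` is constant -/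
  letI : Algebra k₀ Λ := (algebraMapΓ gk).toAlgebra
  set ek := Scheme.ΓSpecIso (.of k₀) with hek
  have hint : ∀ x : Λ, IsIntegral k₀ x := by
    intro x
    obtain ⟨p, hp, hpx⟩ := isIntegral_appTop_of_universallyClosed gk x
    refine ⟨p.map ek.hom.hom, hp.map _, ?_⟩
    rw [Polynomial.eval₂_map]
    convert hpx using 2
    ext a
    change gk.appTop.hom (ek.inv (ek.hom a)) = gk.appTop.hom a
    rw [Iso.hom_inv_id_apply]
  have hsurj : Function.Surjective (algebraMapΓ gk) := by
    intro b
    have hu := isUnit_aeval_derivative_minpoly (hint b)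
    set μ := minpoly k₀ b with hμ
    have hroot : (μ.map (algebraMapΓ gk)).IsRoot b := by
      rw [IsRoot.def, eval_map]; exact minpoly.aeval _ b
    have hroot' : (μ.map (algebraMapΓ (pullback.snd g j))).IsRoot (mk.appTop b) := by
      rw [hcomp, ← Polynomial.map_map]
      exact IsRoot.map hroot
    have hunit' : IsUnit ((μ.map (algebraMapΓ (pullback.snd g j))).derivative.eval (mk.appTop b)) := by
      rw [hcomp, ← Polynomial.map_map, Polynomial.derivative_map, eval_map, eval₂_hom]
      refine (IsUnit.map _ ?_)
      rw [Polynomial.derivative_map, eval_map]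
      exact hu
    obtain ⟨c, hc⟩ := mem_range_algebraMapΓ_of_isRoot g q hFF hq hΓ' μ (minpoly.monic (hint b))
      (mk.appTop b) hroot' hunit'
    -- `b - c` pulls back to `0` on `Z₀`, hence is nilpotent, hence zero
    have h0 : mk.app ⊤ (b - algebraMapΓ gk c) = 0 := by
      change mk.appTop (b - algebraMapΓ gk c) = 0
      rw [map_sub, sub_eq_zero, ← hc, hcomp]
      rfl
    haveI : CompactSpace ↥(pullback f j) := QuasiCompact.compactSpace_of_compactSpace gk
    have hnil := isNilpotent_of_app_eq_zero mk (U := ⊤) isCompact_univ _ h0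
    exact ⟨c, (sub_eq_zero.mp hnil.eq_zero).symm⟩
  haveI : Nonempty ↥(⊤ : (pullback f j).Opens) := ⟨⟨Classical.arbitrary _, trivial⟩⟩
  have hinj : Function.Injective (algebraMapΓ gk) := (algebraMapΓ gk).injective
  have hbij : Function.Bijective gk.appTop := by
    have : gk.appTop.hom = (algebraMapΓ gk).comp ek.hom.hom := by
      ext a
      change gk.appTop.hom a = gk.appTop.hom (ek.inv (ek.hom a))
      rw [Iso.hom_inv_id_apply]
    change Function.Bijective gk.appTop.hom
    rw [this]
    exact (Function.Bijective.of_comp_iff' ⟨hinj, hsurj⟩ _).mpr ek.commRingCatIsoToRingEquiv.bijective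
  exact (ConcreteCategory.isIso_iff_bijective _).mpr hbij

/-- **Zariski's connectedness theorem over a discrete valuation ring**: the special fibre
`X ×_R k₀` of a proper smooth `X → Spec R` with geometrically irreducible generic fibre is
GEOMETRICALLY CONNECTED over `k₀` (`H⁰(X₀, 𝒪) = k₀` by `isIso_appTop_specialFibre`, then flat base
change, `geometricallyConnected_of_isIso_appTop`). [cite: StacksProject, Tag 03H0 (More on Morphisms, Theorem 37.53.4) with Tags 02O2, 02OC] -/
theorem geometricallyConnected_specialFibre [PerfectField K] [PerfectField k₀]
    (hq : Function.Surjective q) (n : ℕ) [SmoothOfRelativeDimension n f] [IsProper f]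
    [GeometricallyIrreducible (pullback.snd f (Spec.map (CommRingCat.ofHom (algebraMap R K))))] :
    GeometricallyConnected (pullback.snd f (Spec.map (CommRingCat.ofHom q))) := by
  haveI := isIso_appTop_specialFibre (K := K) f q hq n
  haveI := smoothOfRelativeDimension_isStableUnderBaseChange (n := n)
  haveI : Surjective f := surjective_of_isProper (K := K) f n
  set gk := pullback.snd f (Spec.map (CommRingCat.ofHom q)) with hgk
  haveI : Nonempty ↥(pullback f (Spec.map (CommRingCat.ofHom q))) := by
    obtain ⟨y, -⟩ := gk.surjective (Classical.arbitrary _)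
    exact ⟨y⟩
  haveI : CompactSpace ↥(pullback f (Spec.map (CommRingCat.ofHom q))) :=
    QuasiCompact.compactSpace_of_compactSpace gk
  haveI : QuasiSeparatedSpace ↥(pullback f (Spec.map (CommRingCat.ofHom q))) :=
    quasiSeparatedSpace_of_quasiSeparated gk
  exact geometricallyConnected_of_isIso_appTop gk

/-- **Zariski's connectedness theorem over a discrete valuation ring, irreducible form** (Stacks
Project, Tag 0E0N; EGA IV₃ 15.5.4; SGA 1 X 1.2): the special fibre `X ×_R k₀` of a proper smooth
`X → Spec R` with geometrically irreducible generic fibre is GEOMETRICALLY IRREDUCIBLE over `k₀` —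
geometrically connected (`geometricallyConnected_specialFibre`) and smooth over `k₀`, hence
geometrically irreducible (Stacks 056T,
`geometricallyIrreducible_of_geometricallyConnected_of_smoothOfRelativeDimension`). Base-generic
form of `IntegralModel.geometricallyIrreducible_reductionAt_holds`.
[cite: StacksProject, Tags 03H0, 0E0N and 056T (More on Morphisms, Theorem 37.53.4; Varieties, Lemma 33.25.4)] -/
theorem geometricallyIrreducible_specialFibre [PerfectField K] [PerfectField k₀]
    (hq : Function.Surjective q) (n : ℕ) [SmoothOfRelativeDimension n f] [IsProper f]
    [GeometricallyIrreducible (pullback.snd f (Spec.map (CommRingCat.ofHom (algebraMap R K))))] :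
    GeometricallyIrreducible (pullback.snd f (Spec.map (CommRingCat.ofHom q))) := by
  haveI := geometricallyConnected_specialFibre (K := K) f q hq n
  haveI := smoothOfRelativeDimension_isStableUnderBaseChange (n := n)
  haveI : SmoothOfRelativeDimension n (pullback.snd f (Spec.map (CommRingCat.ofHom q))) :=
    MorphismProperty.pullback_snd _ _ ‹_›
  exact geometricallyIrreducible_of_geometricallyConnected_of_smoothOfRelativeDimension
    (pullback.snd f (Spec.map (CommRingCat.ofHom q))) n

/-- **The special fibre of a proper smooth scheme over a DVR with geometrically irreducible generic
fibre is GEOMETRICALLY INTEGRAL** — geometrically irreducible (`geometricallyIrreducible_specialFibre`)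
and geometrically reduced because smooth over `k₀` (`geometricallyReduced_of_smoothOfRelativeDimension`,
Stacks 056T); this is the form in which the special fibre of an abelian scheme over `R` is again an
abelian variety (cf. `IsAbelianSchemeModel.specialFibre` over number rings).
[cite: StacksProject, Tags 0E0N and 056T (Zariski's connectedness theorem; Varieties, Lemma 33.25.4)] -/
theorem geometricallyIntegral_specialFibre [PerfectField K] [PerfectField k₀]
    (hq : Function.Surjective q) (n : ℕ) [SmoothOfRelativeDimension n f] [IsProper f]
    [GeometricallyIrreducible (pullback.snd f (Spec.map (CommRingCat.ofHom (algebraMap R K))))] :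
    GeometricallyIntegral (pullback.snd f (Spec.map (CommRingCat.ofHom q))) := by
  haveI := geometricallyIrreducible_specialFibre (K := K) f q hq n
  haveI := smoothOfRelativeDimension_isStableUnderBaseChange (n := n)
  haveI : SmoothOfRelativeDimension n (pullback.snd f (Spec.map (CommRingCat.ofHom q))) :=
    MorphismProperty.pullback_snd _ _ ‹_›
  haveI : GeometricallyReduced (pullback.snd f (Spec.map (CommRingCat.ofHom q))) :=
    geometricallyReduced_of_smoothOfRelativeDimension _ n
  exact .of_geometricallyReduced_of_geometricallyIrreducible _

/-- The same at the canonical residue field: for `R` a DVR with perfect fraction field `K` and perfect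
residue field, and `f : X → Spec R` proper, smooth of relative dimension `n`, with geometrically
irreducible generic fibre, the fibre over `IsLocalRing.residue R : R ↠ κ(R)` is geometrically
integral. [cite: StacksProject, Tags 0E0N and 056T (Zariski's connectedness theorem; Varieties, Lemma 33.25.4)] -/
theorem geometricallyIntegral_specialFibre_residue [PerfectField K]
    [PerfectField (IsLocalRing.ResidueField R)] (n : ℕ) [SmoothOfRelativeDimension n f] [IsProper f]
    [GeometricallyIrreducible (pullback.snd f (Spec.map (CommRingCat.ofHom (algebraMap R K))))] :
    GeometricallyIntegral
      (pullback.snd f (Spec.map (CommRingCat.ofHom (IsLocalRing.residue R)))) :=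
  geometricallyIntegral_specialFibre (K := K) f (IsLocalRing.residue R) IsLocalRing.residue_surjective n


/-! ### Dedekind base: the fibre at a closed point -/

section Dedekind

variable {R K : Type u} [CommRing R] [IsDedekindDomain R] [Field K] [Algebra R K]
  [IsFractionRing R K] {X : Scheme.{u}} (f : X ⟶ Spec (.of R)) {k₀ : Type u} [Field k₀] (q : R →+* k₀)

/-- **The fibre of a proper smooth scheme over a Dedekind domain at a closed point is geometrically
integral**, granted a geometrically irreducible generic fibre. Let `R` be a Dedekind domain with
perfect fraction field `K`, `q : R ↠ k₀` a surjection onto a perfect field with non-zero kernel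
`𝔪` (a closed point of `Spec R`), and `f : X → Spec R` proper, smooth of relative dimension `n`, with
`X_K` geometrically irreducible. Then `X ×_R k₀` is geometrically integral over `k₀`: base change to
the discrete valuation ring `R_𝔪` (Mathlib
`IsLocalization.AtPrime.isDiscreteValuationRing_of_dedekind_domain`), whose generic fibre is `X_K`
and whose special fibre is `X ×_R k₀` (pullback pasting, `pullbackLeftPullbackSndIso`), and
`ZariskiDVR.geometricallyIntegral_specialFibre`. This is the form consumed by an induction on
transcendence degree over a `p`-adic field (all residue fields of characteristic `0`): the special
fibre of an abelian scheme over `R[1/f]` at every closed point is again an abelian variety.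
[cite: StacksProject, Tags 0E0N and 056T (Zariski's connectedness theorem; Varieties, Lemma 33.25.4)] -/
theorem geometricallyIntegral_fibre_of_isDedekindDomain [PerfectField K] [PerfectField k₀]
    (hq : Function.Surjective q) (hq0 : RingHom.ker q ≠ ⊥)
    (n : ℕ) [SmoothOfRelativeDimension n f] [IsProper f]
    [GeometricallyIrreducible (pullback.snd f (Spec.map (CommRingCat.ofHom (algebraMap R K))))] :
    GeometricallyIntegral (pullback.snd f (Spec.map (CommRingCat.ofHom q))) := by
  classical
  haveI := smoothOfRelativeDimension_isStableUnderBaseChange (n := n)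
  -- the closed point `𝔪 = ker q` and the discrete valuation ring `R_𝔪`
  haveI h𝔪 : (RingHom.ker q).IsMaximal := RingHom.ker_isMaximal_of_surjective q hq
  haveI : IsDiscreteValuationRing (Localization.AtPrime (RingHom.ker q)) :=
    IsLocalization.AtPrime.isDiscreteValuationRing_of_dedekind_domain R hq0 _
  -- `K` is the fraction field of `R_𝔪`
  have hunits : ∀ s : (RingHom.ker q).primeCompl, IsUnit (algebraMap R K s) := by
    intro s
    refine IsUnit.mk0 _ fun h => s.2 ?_
    have hs : (s : R) = 0 := IsFractionRing.injective R K (h.trans (map_zero _).symm)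
    change (s : R) ∈ RingHom.ker q
    rw [hs]
    exact zero_mem _
  letI : Algebra (Localization.AtPrime (RingHom.ker q)) K :=
    (IsLocalization.lift (M := (RingHom.ker q).primeCompl)
      (S := Localization.AtPrime (RingHom.ker q)) hunits).toAlgebra
  haveI : IsScalarTower R (Localization.AtPrime (RingHom.ker q)) K :=
    IsScalarTower.of_algebraMap_eq fun x =>
      (IsLocalization.lift_eq (M := (RingHom.ker q).primeCompl) hunits x).symm
  haveI : IsFractionRing (Localization.AtPrime (RingHom.ker q)) K :=
    IsFractionRing.isFractionRing_of_isDomain_of_isLocalization (RingHom.ker q).primeCompl _ K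
  -- `q` factors through a surjection `q' : R_𝔪 ↠ k₀`
  have hunitsq : ∀ s : (RingHom.ker q).primeCompl, IsUnit (q s) := fun s =>
    IsUnit.mk0 _ fun h => s.2 (show (s : R) ∈ RingHom.ker q from (RingHom.mem_ker).mpr h)
  set q' : Localization.AtPrime (RingHom.ker q) →+* k₀ :=
    IsLocalization.lift (M := (RingHom.ker q).primeCompl) hunitsq with hq'def
  have hq'comp : q'.comp (algebraMap R (Localization.AtPrime (RingHom.ker q))) = q :=
    IsLocalization.lift_comp hunitsq
  have hq' : Function.Surjective q' := fun y => by
    obtain ⟨x, rfl⟩ := hq y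
    exact ⟨algebraMap R _ x, IsLocalization.lift_eq hunitsq x⟩
  -- base change of `f` to `R_𝔪`
  set a : Spec (.of (Localization.AtPrime (RingHom.ker q))) ⟶ Spec (.of R) :=
    Spec.map (CommRingCat.ofHom (algebraMap R (Localization.AtPrime (RingHom.ker q)))) with ha
  set f' := pullback.snd f a with hf'
  haveI : SmoothOfRelativeDimension n f' := MorphismProperty.pullback_snd _ _ ‹_›
  -- its generic fibre is the generic fibre of `f`
  have hK : Spec.map (CommRingCat.ofHom (algebraMap (Localization.AtPrime (RingHom.ker q)) K)) ≫ a =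
      Spec.map (CommRingCat.ofHom (algebraMap R K)) := by
    rw [ha, ← Spec.map_comp, ← CommRingCat.ofHom_comp,
      ← IsScalarTower.algebraMap_eq R (Localization.AtPrime (RingHom.ker q)) K]
  haveI : GeometricallyIrreducible (pullback.snd f'
      (Spec.map (CommRingCat.ofHom (algebraMap (Localization.AtPrime (RingHom.ker q)) K)))) := by
    have hgi : GeometricallyIrreducible (pullback.snd f
        (Spec.map (CommRingCat.ofHom (algebraMap (Localization.AtPrime (RingHom.ker q)) K)) ≫ a)) := by
      rw [hK]; infer_instance
    rw [hf', ← pullbackLeftPullbackSndIso_hom_snd f a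
      (Spec.map (CommRingCat.ofHom (algebraMap (Localization.AtPrime (RingHom.ker q)) K)))]
    exact MorphismProperty.RespectsIso.precomp (P := @GeometricallyIrreducible) _ _ hgi
  -- its special fibre is the fibre of `f` over `𝔪`
  have hk : Spec.map (CommRingCat.ofHom q') ≫ a = Spec.map (CommRingCat.ofHom q) := by
    rw [ha, ← Spec.map_comp, ← CommRingCat.ofHom_comp, hq'comp]
  have H := geometricallyIntegral_specialFibre (K := K) f' q' hq' n
  have hsnd : pullback.snd f (Spec.map (CommRingCat.ofHom q') ≫ a) =
      (pullbackLeftPullbackSndIso f a (Spec.map (CommRingCat.ofHom q'))).inv ≫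
        pullback.snd f' (Spec.map (CommRingCat.ofHom q')) := by
    rw [Iso.eq_inv_comp, pullbackLeftPullbackSndIso_hom_snd]
  rw [← hk, hsnd]
  exact MorphismProperty.RespectsIso.precomp (P := @GeometricallyIntegral) _ _ H

end Dedekind


/-! ### Plain `Smooth` hypothesis (no fixed relative dimension) -/

section Smooth

variable {R K : Type u} [CommRing R] [IsDomain R] [IsDiscreteValuationRing R] [Field K] [Algebra R K]
  [IsFractionRing R K] {X : Scheme.{u}} (f : X ⟶ Spec (.of R)) {k₀ : Type u} [Field k₀] (q : R →+* k₀)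

omit [IsDiscreteValuationRing R] in
/-- A smooth `X → Spec R` (`R` a domain with fraction field `K`) with geometrically irreducible
generic fibre is smooth of SOME fixed relative dimension: `X` is irreducible (its generic fibre is
irreducible and dense, `ZariskiChow.irreducibleSpace_of_genericFibre`) and the relative dimension of
a smooth morphism with irreducible source is constant (`exists_smoothOfRelativeDimension_of_smooth`,
Görtz–Wedhorn I, Prop. 6.15). [cite: GortzWedhorn2020, Prop. 6.15 (1)] -/
theorem exists_smoothOfRelativeDimension [Smooth f]
    [GeometricallyIrreducible (pullback.snd f (Spec.map (CommRingCat.ofHom (algebraMap R K))))] :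
    ∃ n : ℕ, SmoothOfRelativeDimension n f := by
  haveI : IrreducibleSpace ↥(pullback f (Spec.map (CommRingCat.ofHom (algebraMap R K)))) :=
    GeometricallyIrreducible.irreducibleSpace_of_subsingleton
      (f := pullback.snd f (Spec.map (CommRingCat.ofHom (algebraMap R K))))
  haveI : IrreducibleSpace ↥X := ZariskiChow.irreducibleSpace_of_genericFibre (K := K) f
  exact exists_smoothOfRelativeDimension_of_smooth f

/-- **Zariski over a DVR, plain `Smooth` hypothesis**: for `R` a DVR with perfect fraction field `K`,
`q : R ↠ k₀` a surjection onto a perfect field and `f : X → Spec R` proper and SMOOTH with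
geometrically irreducible generic fibre, the special fibre `X ×_R k₀` is geometrically integral
(`geometricallyIntegral_specialFibre` at the relative dimension provided by
`exists_smoothOfRelativeDimension`). This is the shape delivered by the tree's spreading-out theorem
`exists_abelianScheme_away_holds` (`IsProper 𝒜.X.hom ∧ Smooth 𝒜.X.hom`).
[cite: StacksProject, Tags 0E0N and 056T (Zariski's connectedness theorem; Varieties, Lemma 33.25.4)] -/
theorem geometricallyIntegral_specialFibre_of_smooth [PerfectField K] [PerfectField k₀]
    (hq : Function.Surjective q) [Smooth f] [IsProper f]
    [GeometricallyIrreducible (pullback.snd f (Spec.map (CommRingCat.ofHom (algebraMap R K))))] :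
    GeometricallyIntegral (pullback.snd f (Spec.map (CommRingCat.ofHom q))) := by
  obtain ⟨n, hn⟩ := exists_smoothOfRelativeDimension (K := K) f
  exact geometricallyIntegral_specialFibre (K := K) f q hq n

end Smooth

section DedekindSmooth

variable {R K : Type u} [CommRing R] [IsDedekindDomain R] [Field K] [Algebra R K]
  [IsFractionRing R K] {X : Scheme.{u}} (f : X ⟶ Spec (.of R)) {k₀ : Type u} [Field k₀] (q : R →+* k₀)

/-- **Fibre at a closed point over a Dedekind base, plain `Smooth` hypothesis**: for `R` Dedekind
with perfect fraction field `K`, `q : R ↠ k₀` a surjection onto a perfect field with `ker q ≠ ⊥`,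
and `f : X → Spec R` proper and SMOOTH with geometrically irreducible generic fibre, the fibre
`X ×_R k₀` is geometrically integral. With properness and the group structure by base change this
makes the special fibre at every closed point of the proper smooth group scheme produced by
`exists_abelianScheme_away_holds` an abelian variety over the residue field.
[cite: StacksProject, Tags 0E0N and 056T (Zariski's connectedness theorem; Varieties, Lemma 33.25.4)] -/
theorem geometricallyIntegral_fibre_of_isDedekindDomain_of_smooth [PerfectField K] [PerfectField k₀]
    (hq : Function.Surjective q) (hq0 : RingHom.ker q ≠ ⊥) [Smooth f] [IsProper f]
    [GeometricallyIrreducible (pullback.snd f (Spec.map (CommRingCat.ofHom (algebraMap R K))))] :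
    GeometricallyIntegral (pullback.snd f (Spec.map (CommRingCat.ofHom q))) := by
  obtain ⟨n, hn⟩ := exists_smoothOfRelativeDimension (K := K) f
  exact geometricallyIntegral_fibre_of_isDedekindDomain (K := K) f q hq hq0 n

end DedekindSmooth

end Literature.AlgebraicGeometry.Motives.ZariskiDVR

end
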